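import Mathlib
import HarnessLib

/-!
# Route MarkovRigidity, support item `FieldRealisation` (stmt-CriticalPhenomena-11245):
# two probabilistic tools — moments along weak limits, exponential moments from Gaussian bounds

Helper towards clause (b) of `FieldRealisation` (passage of moments and exponential moments from
the smeared lattice laws to the continuum law).  Pure measure theory, no lattice input:

* `tendsto_integral_of_forall_sq_integral_le` — if probability measures `P i → P₀` weakly on a
  topological space and a continuous real `g` has UNIFORMLY BOUNDED SECOND MOMENTS
  `∫ g² dP i ≤ K`, then `∫ g dP i → ∫ g dP₀`, `g ∈ L²(P₀)` with `∫ g² dP₀ ≤ K`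
  (truncation `x ↦ max(−R, min(x, R))`, whose error is at most `x²/R`; Billingsley, Thm. 3.5);
* `integrable_exp_mul_abs_of_even_moments` — if `∫ h^{2k} dP ≤ (2k)!/(2ᵏk!) Vᵏ` for all `k`
  (Gaussian domination of the even moments) then `exp(t|h|)` is integrable for every `t`
  (`e^{t|x|} ≤ 2 cosh(tx) = 2 Σ (tx)^{2k}/(2k)!`, monotone convergence; Newman 1975).

References: Billingsley, *Convergence of Probability Measures* (1999), Thm. 3.5; Newman,
Z. Wahrsch. 33 (1975).  No definitions are introduced.
-/

noncomputable section

namespace Summit.CriticalPhenomena.Ising3DConformalLimit.MarkovRigidityFieldRealisation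

open MeasureTheory Filter BoundedContinuousFunction
open scoped ENNReal Topology Nat

/-! ### Truncation -/

/-- The truncation error: `|x − max(−R, min(x, R))| ≤ x² / R` for `R > 0`. [folklore] -/
theorem abs_sub_trunc_le {R : ℝ} (hR : 0 < R) (x : ℝ) : |x - max (-R) (min x R)| ≤ x ^ 2 / R := by
  rw [le_div_iff₀ hR]
  rcases le_or_gt x R with hxR | hxR
  · rcases le_or_gt (-R) x with hRx | hRx
    · rw [min_eq_left hxR, max_eq_right hRx, sub_self, abs_zero, zero_mul]; positivity
    · rw [min_eq_left hxR, max_eq_left hRx.le]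
      rw [show x - -R = x + R by ring, abs_of_neg (by linarith)]
      nlinarith
  · rw [min_eq_right hxR.le, max_eq_right (by linarith), abs_of_pos (by linarith)]
    nlinarith

/-- The truncation is bounded by `R`. [folklore] -/
theorem abs_trunc_le {R : ℝ} (hR : 0 ≤ R) (x : ℝ) : |max (-R) (min x R)| ≤ R := by
  rw [abs_le]
  exact ⟨le_max_left _ _, max_le (by linarith) (min_le_right _ _)⟩

/-- The squared truncation is at most `x²` (`R ≥ 0`). [folklore] -/
theorem trunc_sq_le {R : ℝ} (hR : 0 ≤ R) (x : ℝ) : (max (-R) (min x R)) ^ 2 ≤ x ^ 2 := by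
  rcases le_or_gt x R with hxR | hxR
  · rcases le_or_gt (-R) x with hRx | hRx
    · rw [min_eq_left hxR, max_eq_right hRx]
    · rw [min_eq_left hxR, max_eq_left hRx.le]; nlinarith
  · rw [min_eq_right hxR.le, max_eq_right (by linarith)]; nlinarith

/-- The truncated observable as a bounded continuous function. [folklore] -/
theorem exists_bcf_trunc {Ω : Type*} [TopologicalSpace Ω] (g : Ω → ℝ) (hg : Continuous g)
    {R : ℝ} (hR : 0 ≤ R) :
    ∃ fb : Ω →ᵇ ℝ, ∀ ω, fb ω = max (-R) (min (g ω) R) := by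
  refine ⟨BoundedContinuousFunction.mkOfBound ⟨fun ω => max (-R) (min (g ω) R), ?_⟩ (2 * R)
    fun ω ω' => ?_, fun ω => rfl⟩
  · exact continuous_const.max (hg.min continuous_const)
  · rw [Real.dist_eq]
    have h1 := abs_trunc_le hR (g ω)
    have h2 := abs_trunc_le hR (g ω')
    rw [abs_le] at h1 h2 ⊢
    simp only [ContinuousMap.coe_mk]
    constructor <;> linarith [h1.1, h1.2, h2.1, h2.2]

/-- The squared truncation is `min(x², R²)` for `R ≥ 0`. [folklore] -/
theorem trunc_sq_eq_min {R : ℝ} (hR : 0 ≤ R) (x : ℝ) : (max (-R) (min x R)) ^ 2 = min (x ^ 2) (R ^ 2) := by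
  rcases le_or_gt x R with hxR | hxR
  · rcases le_or_gt (-R) x with hRx | hRx
    · rw [min_eq_left hxR, max_eq_right hRx, min_eq_left (sq_le_sq' hRx hxR)]
    · rw [min_eq_left hxR, max_eq_left hRx.le, min_eq_right, neg_sq]
      nlinarith
  · rw [min_eq_right hxR.le, max_eq_right (by linarith), min_eq_right]
    nlinarith

/-! ### Moments along weak limits -/

/-- On a probability space, `g` is integrable once `g²` is (`|g| ≤ (1 + g²)/2`). [folklore] -/
theorem integrable_of_integrable_sq {Ω : Type*} [MeasurableSpace Ω] {Q : Measure Ω}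
    [IsFiniteMeasure Q] {g : Ω → ℝ} (hgm : AEStronglyMeasurable g Q)
    (h : Integrable (fun ω => g ω ^ 2) Q) : Integrable g Q := by
  refine Integrable.mono' ((integrable_const (1 : ℝ)).add h |>.div_const 2) hgm
    (Eventually.of_forall fun ω => ?_)
  rw [Real.norm_eq_abs]
  have : 0 ≤ (|g ω| - 1) ^ 2 := sq_nonneg _
  have h2 : |g ω| ^ 2 = g ω ^ 2 := sq_abs _
  simp only [Pi.add_apply]
  nlinarith

/-- **Second moments pass to weak limits as an upper bound**, and the limit observable is square
integrable: if `P i → P₀` weakly and `g²` is integrable with `∫ g² dP i ≤ K` eventually, then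
`g ∈ L²(P₀)` and `∫ g² dP₀ ≤ K`. [cite: BillingsleyCPM1999, Thm. 3.5] -/
theorem sq_integral_le_of_tendsto {Ω : Type*} [MeasurableSpace Ω] [TopologicalSpace Ω]
    [OpensMeasurableSpace Ω] {ι : Type*} {l : Filter ι} [l.NeBot]
    {P : ι → ProbabilityMeasure Ω} {P₀ : ProbabilityMeasure Ω} (hP : Tendsto P l (𝓝 P₀))
    {g : Ω → ℝ} (hg : Continuous g) {K : ℝ}
    (hK : ∀ᶠ i in l, Integrable (fun ω => g ω ^ 2) (P i : Measure Ω) ∧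
      ∫ ω, g ω ^ 2 ∂(P i : Measure Ω) ≤ K) :
    MemLp g 2 (P₀ : Measure Ω) ∧ ∫ ω, g ω ^ 2 ∂(P₀ : Measure Ω) ≤ K := by
  have hgm : ∀ Q : Measure Ω, AEStronglyMeasurable g Q := fun Q => hg.aestronglyMeasurable
  have hK0 : 0 ≤ K := by
    obtain ⟨i, -, hi⟩ := hK.exists
    exact le_trans (integral_nonneg fun ω => sq_nonneg _) hi
  -- truncated second moments of the limit are at most `K`
  have htrunc : ∀ n : ℕ, ∫ ω, (max (-(n : ℝ)) (min (g ω) n)) ^ 2 ∂(P₀ : Measure Ω) ≤ K := by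
    intro n
    obtain ⟨fb, hfb⟩ := exists_bcf_trunc g hg (Nat.cast_nonneg n)
    have hlim := (ProbabilityMeasure.tendsto_iff_forall_integral_tendsto.1 hP) (fb * fb)
    have heq : ∀ Q : Measure Ω, ∫ ω, (fb * fb) ω ∂Q = ∫ ω, (max (-(n : ℝ)) (min (g ω) n)) ^ 2 ∂Q := by
      intro Q; congr 1; funext ω; rw [BoundedContinuousFunction.coe_mul, Pi.mul_apply, hfb, sq]
    simp_rw [heq] at hlim
    refine le_of_tendsto hlim (hK.mono fun i hi => le_trans ?_ hi.2)
    refine integral_mono_of_nonneg (Eventually.of_forall fun ω => sq_nonneg _) hi.1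
      (Eventually.of_forall fun ω => trunc_sq_le (Nat.cast_nonneg n) _)
  -- monotone convergence in `n`
  set f : ℕ → Ω → ℝ≥0∞ := fun n ω => ENNReal.ofReal ((max (-(n : ℝ)) (min (g ω) n)) ^ 2) with hf
  have hfm : ∀ n, Measurable (f n) := fun n =>
    ENNReal.measurable_ofReal.comp ((continuous_const.max (hg.min continuous_const)).pow 2).measurable
  have hmono : ∀ ω, Monotone fun n => f n ω := by
    intro ω m n hmn
    simp only [hf]
    refine ENNReal.ofReal_le_ofReal ?_
    rw [trunc_sq_eq_min (Nat.cast_nonneg m), trunc_sq_eq_min (Nat.cast_nonneg n)]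
    exact min_le_min le_rfl (by gcongr)
  have htend : ∀ ω, Tendsto (fun n => f n ω) atTop (𝓝 (ENNReal.ofReal (g ω ^ 2))) := by
    intro ω
    refine tendsto_atTop_of_eventually_const (i₀ := ⌈|g ω|⌉₊) fun n hn => ?_
    simp only [hf]
    rw [trunc_sq_eq_min (Nat.cast_nonneg n), min_eq_left]
    have h1 : |g ω| ≤ n := (Nat.le_ceil _).trans (by exact_mod_cast hn)
    calc g ω ^ 2 = |g ω| ^ 2 := (sq_abs _).symm
      _ ≤ (n : ℝ) ^ 2 := pow_le_pow_left₀ (abs_nonneg _) h1 2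
  have hlin := lintegral_tendsto_of_tendsto_of_monotone (μ := (P₀ : Measure Ω))
    (fun n => (hfm n).aemeasurable) (Eventually.of_forall hmono) (Eventually.of_forall htend)
  have hbound : ∫⁻ ω, ENNReal.ofReal (g ω ^ 2) ∂(P₀ : Measure Ω) ≤ ENNReal.ofReal K := by
    refine le_of_tendsto' hlin fun n => ?_
    have hint : Integrable (fun ω => (max (-(n : ℝ)) (min (g ω) n)) ^ 2) (P₀ : Measure Ω) := by
      refine Integrable.of_bound ((continuous_const.max (hg.min continuous_const)).pow 2
        |>.aestronglyMeasurable) ((n : ℝ) ^ 2) (Eventually.of_forall fun ω => ?_)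
      rw [Real.norm_eq_abs, abs_of_nonneg (sq_nonneg _), trunc_sq_eq_min (Nat.cast_nonneg n)]
      exact min_le_right _ _
    simp only [hf]
    rw [← ofReal_integral_eq_lintegral_ofReal hint (Eventually.of_forall fun ω => sq_nonneg _)]
    exact ENNReal.ofReal_le_ofReal (htrunc n)
  have hsqint : Integrable (fun ω => g ω ^ 2) (P₀ : Measure Ω) := by
    refine ⟨(hg.pow 2).aestronglyMeasurable, ?_⟩
    rw [hasFiniteIntegral_iff_ofReal (Eventually.of_forall fun ω => sq_nonneg _)]
    exact hbound.trans_lt ENNReal.ofReal_lt_top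
  refine ⟨(memLp_two_iff_integrable_sq (hgm _)).2 hsqint, ?_⟩
  rw [integral_eq_lintegral_of_nonneg_ae (Eventually.of_forall fun ω => sq_nonneg _)
    (hg.pow 2).aestronglyMeasurable]
  exact ENNReal.toReal_le_of_le_ofReal hK0 hbound

/-- **First moments converge along weak limits under a uniform second-moment bound**
(uniform integrability by truncation): if `P i → P₀` weakly, `g` is continuous and
`∫ g² dP i ≤ K` eventually, then `∫ g dP i → ∫ g dP₀`. [cite: BillingsleyCPM1999, Thm. 3.5] -/
theorem tendsto_integral_of_forall_sq_integral_le {Ω : Type*} [MeasurableSpace Ω]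
    [TopologicalSpace Ω] [OpensMeasurableSpace Ω] {ι : Type*} {l : Filter ι} [l.NeBot]
    {P : ι → ProbabilityMeasure Ω} {P₀ : ProbabilityMeasure Ω} (hP : Tendsto P l (𝓝 P₀))
    {g : Ω → ℝ} (hg : Continuous g) {K : ℝ}
    (hK : ∀ᶠ i in l, Integrable (fun ω => g ω ^ 2) (P i : Measure Ω) ∧
      ∫ ω, g ω ^ 2 ∂(P i : Measure Ω) ≤ K) :
    Tendsto (fun i => ∫ ω, g ω ∂(P i : Measure Ω)) l (𝓝 (∫ ω, g ω ∂(P₀ : Measure Ω))) := by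
  obtain ⟨hmem, hK₀⟩ := sq_integral_le_of_tendsto hP hg hK
  have hgm : ∀ Q : Measure Ω, AEStronglyMeasurable g Q := fun Q => hg.aestronglyMeasurable
  have hint₀ : Integrable (fun ω => g ω ^ 2) (P₀ : Measure Ω) :=
    (memLp_two_iff_integrable_sq (hgm _)).1 hmem
  have hK0 : 0 ≤ K := le_trans (integral_nonneg fun ω => sq_nonneg _) hK₀
  -- truncation error under any probability measure with `∫ g² ≤ K`
  have herr : ∀ (Q : Measure Ω) [IsProbabilityMeasure Q], Integrable (fun ω => g ω ^ 2) Q →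
      ∫ ω, g ω ^ 2 ∂Q ≤ K → ∀ {R : ℝ}, 0 < R →
      |∫ ω, g ω ∂Q - ∫ ω, max (-R) (min (g ω) R) ∂Q| ≤ K / R := by
    intro Q _ hQi hQK R hR
    have hgi : Integrable g Q := integrable_of_integrable_sq (hgm Q) hQi
    have hti : Integrable (fun ω => max (-R) (min (g ω) R)) Q :=
      Integrable.of_bound ((continuous_const.max (hg.min continuous_const)).aestronglyMeasurable) R
        (Eventually.of_forall fun ω => by rw [Real.norm_eq_abs]; exact abs_trunc_le hR.le _)
    rw [← integral_sub hgi hti]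
    calc |∫ ω, (g ω - max (-R) (min (g ω) R)) ∂Q| ≤ ∫ ω, |g ω - max (-R) (min (g ω) R)| ∂Q :=
          abs_integral_le_integral_abs
      _ ≤ ∫ ω, g ω ^ 2 / R ∂Q := by
          refine integral_mono_of_nonneg (Eventually.of_forall fun ω => abs_nonneg _)
            (hQi.div_const R) (Eventually.of_forall fun ω => abs_sub_trunc_le hR _)
      _ = (∫ ω, g ω ^ 2 ∂Q) / R := integral_div R _
      _ ≤ K / R := div_le_div_of_nonneg_right hQK hR.le
  rw [Metric.tendsto_nhds]
  intro ε hε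
  -- truncation level
  set R : ℝ := 4 * (K + 1) / ε with hRdef
  have hR : 0 < R := by positivity
  have hKR : K / R < ε / 4 := by
    rw [hRdef, div_div_eq_mul_div, div_lt_div_iff₀ (by positivity) (by positivity)]
    nlinarith
  obtain ⟨fb, hfb⟩ := exists_bcf_trunc g hg hR.le
  have hweak := (ProbabilityMeasure.tendsto_iff_forall_integral_tendsto.1 hP) fb
  rw [Metric.tendsto_nhds] at hweak
  filter_upwards [hK, hweak (ε / 2) (by positivity)] with i hi hwi
  have h1 := herr (P i) hi.1 hi.2 hR
  have h2 := herr (P₀ : Measure Ω) hint₀ hK₀ hR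
  simp_rw [hfb] at hwi
  rw [Real.dist_eq] at hwi ⊢
  rw [abs_sub_comm] at h2
  calc |∫ ω, g ω ∂(P i : Measure Ω) - ∫ ω, g ω ∂(P₀ : Measure Ω)|
      = |(∫ ω, g ω ∂(P i : Measure Ω) - ∫ ω, max (-R) (min (g ω) R) ∂(P i : Measure Ω)) +
          (∫ ω, max (-R) (min (g ω) R) ∂(P i : Measure Ω) -
            ∫ ω, max (-R) (min (g ω) R) ∂(P₀ : Measure Ω)) +
          (∫ ω, max (-R) (min (g ω) R) ∂(P₀ : Measure Ω) - ∫ ω, g ω ∂(P₀ : Measure Ω))| := by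
        ring_nf
    _ ≤ K / R + ε / 2 + K / R := by
        refine (abs_add_three _ _ _).trans (add_le_add (add_le_add h1 hwi.le) h2)
    _ < ε := by linarith [hKR]

/-! ### Exponential moments from Gaussian domination of the even moments -/

/-- `exp(t|x|) ≤ 2 cosh(t x)`. [folklore] -/
theorem exp_mul_abs_le_two_mul_cosh (t x : ℝ) : Real.exp (t * |x|) ≤ 2 * Real.cosh (t * x) := by
  rw [Real.cosh_eq]
  rcases le_or_gt 0 x with hx | hx
  · rw [abs_of_nonneg hx]; linarith [Real.exp_pos (-(t * x))]
  · rw [abs_of_neg hx, show t * -x = -(t * x) by ring]; linarith [Real.exp_pos (t * x)]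

/-- **Exponential moments from Gaussian domination of the even moments** (Newman 1975): if `h` is
measurable with `∫ h^{2k} dP ≤ (2k)!/(2ᵏk!) Vᵏ` (and `h^{2k}` integrable) for all `k`, then
`∫⁻ exp(t|h|) dP ≤ 2 exp(t²V/2)`; in particular `exp(t|h|)` and `exp(t h)` are integrable.
[cite: GlimmJaffe1987, §6.1] -/
theorem lintegral_exp_mul_abs_le_of_even_moments {Ω : Type*} [MeasurableSpace Ω] {P : Measure Ω}
    {h : Ω → ℝ} (hm : Measurable h) {V : ℝ} (hV : 0 ≤ V)
    (hint : ∀ k : ℕ, Integrable (fun ω => h ω ^ (2 * k)) P)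
    (hmom : ∀ k : ℕ, ∫ ω, h ω ^ (2 * k) ∂P ≤ ((2 * k)! : ℝ) / (2 ^ k * k !) * V ^ k) (t : ℝ) :
    ∫⁻ ω, ENNReal.ofReal (Real.exp (t * |h ω|)) ∂P ≤
      2 * ENNReal.ofReal (Real.exp (t ^ 2 * V / 2)) := by
  -- `exp(t|h|) ≤ 2 cosh(t h) = 2 Σ_k (t h)^{2k}/(2k)!`
  have hpt : ∀ ω, ENNReal.ofReal (Real.exp (t * |h ω|)) ≤
      2 * ∑' k : ℕ, ENNReal.ofReal ((t * h ω) ^ (2 * k) / (2 * k)!) := by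
    intro ω
    have hcosh := Real.hasSum_cosh (t * h ω)
    have hnn : ∀ k : ℕ, 0 ≤ (t * h ω) ^ (2 * k) / ((2 * k)! : ℝ) := fun k =>
      div_nonneg (by rw [pow_mul]; exact pow_nonneg (sq_nonneg _) _) (Nat.cast_nonneg _)
    rw [← ENNReal.ofReal_tsum_of_nonneg hnn hcosh.summable, hcosh.tsum_eq, ← ENNReal.ofReal_ofNat,
      ← ENNReal.ofReal_mul (by norm_num)]
    exact ENNReal.ofReal_le_ofReal (exp_mul_abs_le_two_mul_cosh t (h ω))
  calc ∫⁻ ω, ENNReal.ofReal (Real.exp (t * |h ω|)) ∂P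
      ≤ ∫⁻ ω, 2 * ∑' k : ℕ, ENNReal.ofReal ((t * h ω) ^ (2 * k) / (2 * k)!) ∂P := lintegral_mono hpt
    _ = 2 * ∑' k : ℕ, ∫⁻ ω, ENNReal.ofReal ((t * h ω) ^ (2 * k) / (2 * k)!) ∂P := by
        rw [lintegral_const_mul' _ _ (by norm_num), lintegral_tsum fun k => ?_]
        exact (ENNReal.measurable_ofReal.comp
          (((hm.const_mul t).pow_const (2 * k)).div_const _)).aemeasurable
    _ ≤ 2 * ∑' k : ℕ, ENNReal.ofReal ((t ^ 2 * V / 2) ^ k / k !) := by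
        refine mul_le_mul_right (ENNReal.tsum_le_tsum fun k => ?_) _
        have hnn : 0 ≤ᵐ[P] fun ω => (t * h ω) ^ (2 * k) / ((2 * k)! : ℝ) :=
          Eventually.of_forall fun ω => div_nonneg (by rw [pow_mul]; exact pow_nonneg (sq_nonneg _) _)
            (Nat.cast_nonneg _)
        have hik : Integrable (fun ω => (t * h ω) ^ (2 * k) / ((2 * k)! : ℝ)) P := by
          have := (hint k).const_mul (t ^ (2 * k)) |>.div_const ((2 * k)! : ℝ)
          refine this.congr (Eventually.of_forall fun ω => ?_)
          simp only [mul_pow]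
        rw [← ofReal_integral_eq_lintegral_ofReal hik hnn]
        refine ENNReal.ofReal_le_ofReal ?_
        rw [integral_div]
        have hfac : (0 : ℝ) < (2 * k)! := by exact_mod_cast Nat.factorial_pos _
        calc (∫ ω, (t * h ω) ^ (2 * k) ∂P) / (2 * k)!
            = t ^ (2 * k) * (∫ ω, h ω ^ (2 * k) ∂P) / (2 * k)! := by
              simp_rw [mul_pow]; rw [integral_const_mul]
          _ ≤ t ^ (2 * k) * (((2 * k)! : ℝ) / (2 ^ k * k !) * V ^ k) / (2 * k)! := by
              gcongr
              · rw [pow_mul]; exact pow_nonneg (sq_nonneg _) _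
              · exact hmom k
          _ = (t ^ 2 * V / 2) ^ k / k ! := by
              have e : (t ^ 2 * V / 2) ^ k = t ^ (2 * k) * V ^ k / 2 ^ k := by
                rw [div_pow, mul_pow, ← pow_mul]
              rw [e]
              field_simp [hfac.ne']
    _ = 2 * ENNReal.ofReal (Real.exp (t ^ 2 * V / 2)) := by
        congr 1
        have hexp := NormedSpace.expSeries_div_hasSum_exp (t ^ 2 * V / 2)
        rw [show NormedSpace.exp (t ^ 2 * V / 2) = Real.exp (t ^ 2 * V / 2) from
          (congrFun Real.exp_eq_exp_ℝ _).symm] at hexp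
        rw [← ENNReal.ofReal_tsum_of_nonneg (fun k => by positivity) hexp.summable, hexp.tsum_eq]

/-- Under Gaussian domination of the even moments, `exp(t h)` is integrable on a finite measure
space. [cite: GlimmJaffe1987, §6.1] -/
theorem integrable_exp_mul_of_even_moments {Ω : Type*} [MeasurableSpace Ω] {P : Measure Ω}
    [IsFiniteMeasure P] {h : Ω → ℝ} (hm : Measurable h) {V : ℝ} (hV : 0 ≤ V)
    (hint : ∀ k : ℕ, Integrable (fun ω => h ω ^ (2 * k)) P)
    (hmom : ∀ k : ℕ, ∫ ω, h ω ^ (2 * k) ∂P ≤ ((2 * k)! : ℝ) / (2 ^ k * k !) * V ^ k) (t : ℝ) :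
    Integrable (fun ω => Real.exp (t * h ω)) P := by
  have hle := lintegral_exp_mul_abs_le_of_even_moments hm hV hint hmom |t|
  refine ⟨(Real.continuous_exp.measurable.comp (hm.const_mul t)).aestronglyMeasurable, ?_⟩
  rw [hasFiniteIntegral_iff_ofReal (Eventually.of_forall fun ω => (Real.exp_pos _).le)]
  refine lt_of_le_of_lt (lintegral_mono fun ω => ENNReal.ofReal_le_ofReal ?_)
    (hle.trans_lt (ENNReal.mul_lt_top (by simp) ENNReal.ofReal_lt_top))
  exact Real.exp_le_exp.2 ((le_abs_self _).trans (by rw [abs_mul]))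

end Summit.CriticalPhenomena.Ising3DConformalLimit.MarkovRigidityFieldRealisation

end
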